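import Literature.NumberTheory.LFunctions.ConreyIwaniec2002ThetaOmegaDual
import Literature.NumberTheory.LFunctions.ConreyIwaniec2002ThetaBinaryForms
import Literature.NumberTheory.LFunctions.ConreyIwaniec2002ThetaConstant
import Literature.NumberTheory.Automorphic.BinaryThetaCuspTransform
import HarnessLib

/-!
# Conrey–Iwaniec (2002), §3 (3.14)–(3.18): reassembly over `Cl(K)` — the `ω`-relation of
# `θ(·;ψ)` at every cusp `a/c`, modulo the phase of the quadratic Gauss sum

B. Conrey, H. Iwaniec, Acta Arith. 103 (2002) 259–312, §§2–3: `θ(·;ψ)|_ω = η·θ(·;ψψ_s)`,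
`s = (c,q)`, `r = q/s`, `|η| = 1` (Props 3.2/3.3, Prop. 2.1 (2.35)–(2.38), (3.15)–(3.18)); in the cell
`landau-siegel/ls-inputs` this is the registered stub V1 `stub_theta_omega` (sub-skeleton
`theta-voronoi`, vocabulary `IsOmegaRelated`/`thetaValue`/`thetaConst`). This file PROVES (theorems
only, no definitions, no named facts) the REASSEMBLY STEP `omegaRelated_of_gaussSum_phase`: from the
class-level relation for each binary theta series (`binaryTheta_cusp_omega_relation`, Poisson
summation), the identification of its dual lattice sum with the class theta of `𝒜·[𝔰]`
(`dualLatticeSum_eq_one_add_two_mul_twistedClassSum`) and the expansion of `θ(·;ψ)` over the reduced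
forms (`thetaValue_twistCount_eq_half_sum_binaryTheta`) — IF the untwisted Gauss sums of the reduced
forms have a common phase up to a genus character `g` (`g² = 1`), `G(a,c;Q,0) = E·ν_g(𝔞_Q)` with
`‖E‖ = c√s` (Conrey–Iwaniec's `η = χ_s(a)χ_r(−c)η_F(r,s)ψ_s(𝒜)`, (3.15)/(3.17): the arithmetic of
the binary Gauss sums, NOT done here), THEN the conclusion of V1 holds for this `c` with `ψ' = ψg`,
`η = −i·E·ν_{ψg}(𝔰)/(c√s)`. The regrouping lemma `hasSum_sum_genusClassSum` (the classes
`[𝔰𝔞_Q]⁻¹`, `Q` reduced, partition the nonzero ideals) is the only other ingredient.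
«The programme SEARCHES and TYPES; no claim about Landau–Siegel zeros, Theorems 1–2 of
arXiv:2211.02515 or a repaired Margin232 until a kernel theorem says so.»

## References

* [ConreyIwaniec2002] B. Conrey, H. Iwaniec, Acta Arith. 103 (2002) 259–312: §2 (2.15)–(2.20),
  Proposition 2.1 (2.35)–(2.38); §3 (3.3)–(3.4), (3.14)–(3.18).
* [Cox2013] D. A. Cox, *Primes of the form x² + ny²*, 2nd ed. (2013), §7.B Thm. 7.7.
-/

noncomputable section

open scoped NumberField
open Complex Module NumberField Ideal
open Literature.NumberTheory.QuadraticFields.BinaryQuadraticForm (reducedForms mem_reducedForms_iff)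
open Literature.NumberTheory.QuadraticFields.Quadratic
open Literature.NumberTheory.ModularForms (binQuadGaussSum)
open Literature.NumberTheory.Automorphic (binaryTheta_cusp_omega_relation)

namespace Literature.NumberTheory.LFunctions

namespace ConreyIwaniec2002

open NumberField Literature.NumberTheory.LFunctions.NumberField

variable {K : Type*} [Field K] [NumberField K]

/-! ### Elementary data of a reduced form -/

/-- Bezout from "every common divisor is a unit"; private. [folklore] -/
private theorem exists_bezout₃ {A B C : ℤ} (h : ∀ d : ℤ, d ∣ A → d ∣ B → d ∣ C → IsUnit d) :
    ∃ u v w : ℤ, u * A + v * B + w * C = 1 := by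
  have hg : Int.gcd (Int.gcd A B) C = 1 := by
    have h1 := h (Int.gcd (Int.gcd A B) C)
      ((Int.gcd_dvd_left _ _).trans (Int.gcd_dvd_left _ _))
      ((Int.gcd_dvd_left _ _).trans (Int.gcd_dvd_right _ _)) (Int.gcd_dvd_right _ _)
    have := Int.isUnit_iff_natAbs_eq.1 h1
    rwa [Int.natAbs_natCast] at this
  have e1 := Int.gcd_eq_gcd_ab (Int.gcd A B : ℤ) C
  rw [hg, Int.gcd_eq_gcd_ab A B] at e1
  refine ⟨A.gcdA B * ((A * A.gcdA B + B * A.gcdB B : ℤ)).gcdA C,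
    A.gcdB B * ((A * A.gcdA B + B * A.gcdB B : ℤ)).gcdA C,
    ((A * A.gcdA B + B * A.gcdB B : ℤ)).gcdB C, ?_⟩
  push_cast at e1
  linear_combination -e1

/-- The data of a reduced form `Q = (A, B, C)` of discriminant `t² + 4m = d_K < 0` in the
coordinates `(1, ω)`: `A, C > 0`, `B = 2k − t` with `k = (B + t)/2`, `AC = k² − tk − m`, and the
form is primitive (Bezout form, from `isUnit_of_dvd_of_disc_eq`); private. [folklore] -/
private theorem reducedForm_data (b : Basis (Fin 2) ℤ (𝓞 K)) (hb : b 0 = 1) {t m : ℤ}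
    (hω : b 1 * b 1 = (m : 𝓞 K) + (t : 𝓞 K) * b 1) (hneg : t ^ 2 + 4 * m < 0)
    {Q : ℤ × ℤ × ℤ} (hQ : Q ∈ reducedForms (t ^ 2 + 4 * m)) :
    0 < Q.1 ∧ 0 < Q.2.2 ∧ Q.2.1 = 2 * ((Q.2.1 + t) / 2) - t ∧
      Q.1 * Q.2.2 = ((Q.2.1 + t) / 2) ^ 2 - t * ((Q.2.1 + t) / 2) - m ∧
      Q.2.1 ^ 2 - 4 * Q.1 * Q.2.2 = t ^ 2 + 4 * m ∧
      ∃ u v w : ℤ, u * Q.1 + v * (2 * ((Q.2.1 + t) / 2) - t) + w * Q.2.2 = 1 := by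
  obtain ⟨hdisc, hA, -, -⟩ := (mem_reducedForms_iff hneg).1 hQ
  have hd : Q.2.1 ^ 2 - 4 * Q.1 * Q.2.2 = t ^ 2 + 4 * m := hdisc
  have h2k : 2 * ((Q.2.1 + t) / 2) = Q.2.1 + t :=
    Literature.NumberTheory.EllipticCurves.two_mul_ediv_two_of_disc_eq hd
  have hn := Literature.NumberTheory.EllipticCurves.norm_eq_of_disc_eq hd h2k
  have hC : 0 < Q.2.2 := by nlinarith
  have hB : Q.2.1 = 2 * ((Q.2.1 + t) / 2) - t := by linarith
  refine ⟨hA, hC, hB, hn, hd, ?_⟩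
  rw [← hB]
  exact exists_bezout₃ fun d hdA hdB hdC => isUnit_of_dvd_of_disc_eq b hb hω hd hdA hdB hdC

/-! ### Regrouping over the classes `[𝔰𝔞_Q]⁻¹` -/

/-- **The classes `{𝔞 : 𝔰𝔞_Q𝔞 principal}` (`Q` reduced) partition the nonzero ideals**: for a
nonzero ideal `𝔰` and a summable `G` with `G(0) = 0`,
`Σ_𝔞 G(𝔞) = Σ_{Q ∈ reducedForms d_K} Σ_{𝔞 : 𝔰𝔞_Q𝔞 principal} G(𝔞)` — `Q ↦ [𝔰𝔞_Q]⁻¹` is a bijection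
onto `Cl(K)` (`reducedForms_mk0_bijective` composed with `𝒞 ↦ ([𝔰]𝒞)⁻¹`).
[cite: Cox2013, §7.B Thm. 7.7] -/
theorem hasSum_sum_genusClassSum (b : Basis (Fin 2) ℤ (𝓞 K)) (hb : b 0 = 1) {t m : ℤ}
    (hω : b 1 * b 1 = (m : 𝓞 K) + (t : 𝓞 K) * b 1) (hneg : t ^ 2 + 4 * m < 0)
    {𝔰 : Ideal (𝓞 K)} (h𝔰 : 𝔰 ≠ ⊥) {G : Ideal (𝓞 K) → ℂ} (hG0 : G ⊥ = 0) (hG : Summable G) :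
    HasSum G (∑ Q ∈ reducedForms (t ^ 2 + 4 * m),
      ∑' J : {J : Ideal (𝓞 K) //
        (𝔰 * span {(Q.1 : 𝓞 K), b 1 - (((Q.2.1 + t) / 2 : ℤ) : 𝓞 K)} * J).IsPrincipal}, G J.1) := by
  classical
  set D := t ^ 2 + 4 * m with hDdef
  set 𝔞 : ℤ × ℤ × ℤ → Ideal (𝓞 K) := fun Q =>
    span {(Q.1 : 𝓞 K), b 1 - (((Q.2.1 + t) / 2 : ℤ) : 𝓞 K)} with h𝔞
  have hbij := reducedForms_mk0_bijective b hb hω hneg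
  set Ψ : reducedForms D → _root_.ClassGroup (𝓞 K) := fun Q =>
    ClassGroup.mk0 ⟨_, formIdeal_mem_nonZeroDivisors b hb hneg Q⟩ with hΨ
  have h𝔰0 : 𝔰 ∈ nonZeroDivisors (Ideal (𝓞 K)) := mem_nonZeroDivisors_of_ne_zero h𝔰
  -- pointwise: `G I = Σ_Q [𝔰𝔞_Q I principal] G I`
  have hpt : ∀ I : Ideal (𝓞 K),
      G I = ∑ Q ∈ reducedForms D, Set.indicator {I | (𝔰 * 𝔞 Q * I).IsPrincipal} G I := by
    intro I
    by_cases hI : I = ⊥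
    · rw [hI, hG0]
      refine (Finset.sum_eq_zero fun Q _ => ?_).symm
      by_cases hmem : (⊥ : Ideal (𝓞 K)) ∈ {I | (𝔰 * 𝔞 Q * I).IsPrincipal}
      · rw [Set.indicator_of_mem hmem, hG0]
      · rw [Set.indicator_of_notMem hmem]
    · have hI0 : I ∈ nonZeroDivisors (Ideal (𝓞 K)) := mem_nonZeroDivisors_of_ne_zero hI
      have hiff : ∀ Q : reducedForms D, (𝔰 * 𝔞 Q * I).IsPrincipal ↔
          Ψ Q = (ClassGroup.mk0 ⟨𝔰, h𝔰0⟩ * ClassGroup.mk0 ⟨I, hI0⟩)⁻¹ := by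
        intro Q
        have hne : 𝔰 * 𝔞 Q * I ≠ ⊥ := mul_ne_zero (mul_ne_zero h𝔰
          (nonZeroDivisors.ne_zero (formIdeal_mem_nonZeroDivisors b hb hneg Q))) hI
        rw [← ClassGroup.mk0_eq_one_iff (mem_nonZeroDivisors_of_ne_zero hne)]
        have e : ClassGroup.mk0 ⟨𝔰 * 𝔞 Q * I, mem_nonZeroDivisors_of_ne_zero hne⟩ =
            ClassGroup.mk0 ⟨𝔰, h𝔰0⟩ * Ψ Q * ClassGroup.mk0 ⟨I, hI0⟩ := by
          rw [hΨ, ← map_mul, ← map_mul]; rfl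
        rw [e, eq_inv_iff_mul_eq_one, mul_left_comm, ← mul_assoc]
      obtain ⟨Q₀, hQ₀, huniq⟩ : ∃! Q : reducedForms D,
          Ψ Q = (ClassGroup.mk0 ⟨𝔰, h𝔰0⟩ * ClassGroup.mk0 ⟨I, hI0⟩)⁻¹ :=
        (Function.bijective_iff_existsUnique Ψ).1 hbij _
      rw [Finset.sum_eq_single (Q₀ : ℤ × ℤ × ℤ)]
      · rw [Set.indicator_of_mem]
        exact (hiff Q₀).2 hQ₀
      · intro Q hQ hne
        rw [Set.indicator_of_notMem]
        intro hmem
        have h1 := (hiff ⟨Q, hQ⟩).1 hmem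
        exact hne (congrArg Subtype.val (huniq ⟨Q, hQ⟩ h1))
      · exact fun h => absurd Q₀.2 h
  have hQ : ∀ Q ∈ reducedForms D, HasSum (Set.indicator {I | (𝔰 * 𝔞 Q * I).IsPrincipal} G)
      (∑' J : {J : Ideal (𝓞 K) // (𝔰 * 𝔞 Q * J).IsPrincipal}, G J.1) := by
    intro Q _
    have e : (∑' J : {J : Ideal (𝓞 K) // (𝔰 * 𝔞 Q * J).IsPrincipal}, G J.1) =
        ∑' I, Set.indicator {I | (𝔰 * 𝔞 Q * I).IsPrincipal} G I :=
      tsum_subtype {I | (𝔰 * 𝔞 Q * I).IsPrincipal} G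
    rw [e]
    exact (hG.indicator _).hasSum
  have hsum := hasSum_sum hQ
  have hfunG : (fun I : Ideal (𝓞 K) =>
      ∑ Q ∈ reducedForms D, Set.indicator {I | (𝔰 * 𝔞 Q * I).IsPrincipal} G I) = G :=
    funext fun I => (hpt I).symm
  rwa [hfunG] at hsum

/-! ### Small facts about `ν_χ` and the constant term -/

/-- `ν_{ψφ} = ν_ψ · ν_φ` pointwise; private. [folklore] -/
private theorem nu_mul (ψ φ : ClassGroup (𝓞 K) →* ℂˣ) (I : Ideal (𝓞 K)) :
    classGroupCharIdealHom (ψ * φ) I = classGroupCharIdealHom ψ I * classGroupCharIdealHom φ I := by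
  by_cases hI : I = ⊥
  · simp [hI, classGroupCharIdealHom_bot]
  · rw [classGroupCharIdealHom_apply_of_ne_bot _ hI, classGroupCharIdealHom_apply_of_ne_bot _ hI,
      classGroupCharIdealHom_apply_of_ne_bot _ hI, MonoidHom.mul_apply, Units.val_mul]

/-- `ν_g(𝔞)² = 1` for a real character `g` (`g² = 1`) and `𝔞 ≠ 0`; private. [folklore] -/
private theorem nu_sq_eq_one {g : ClassGroup (𝓞 K) →* ℂˣ} (hgg : g * g = 1) {I : Ideal (𝓞 K)}
    (hI : I ≠ ⊥) : classGroupCharIdealHom g I * classGroupCharIdealHom g I = 1 := by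
  rw [← nu_mul, hgg, classGroupCharIdealHom_apply_of_ne_bot _ hI, MonoidHom.one_apply, Units.val_one]

/-- `‖ν_χ(𝔞)‖ = 1` for `𝔞 ≠ 0`; private. [folklore] -/
private theorem norm_nu {χ : ClassGroup (𝓞 K) →* ℂˣ} {I : Ideal (𝓞 K)} (hI : I ≠ ⊥) :
    ‖classGroupCharIdealHom χ I‖ = 1 := by
  rw [classGroupCharIdealHom_apply_of_ne_bot _ hI, norm_classGroupChar_apply]

/-- The constant term dies unless `χ = 1`, and then `ν_χ ≡ 1`: `thetaConst χ · (1 − ν_χ(𝔞)) = 0`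
for `𝔞 ≠ 0`; private. [folklore] -/
private theorem thetaConst_mul_one_sub_nu (χ : ClassGroup (𝓞 K) →* ℂˣ) {I : Ideal (𝓞 K)}
    (hI : I ≠ ⊥) : thetaConst K χ * (1 - classGroupCharIdealHom χ I) = 0 := by
  classical
  by_cases hχ : χ = 1
  · subst hχ
    rw [classGroupCharIdealHom_apply_of_ne_bot _ hI, MonoidHom.one_apply, Units.val_one, sub_self,
      mul_zero]
  · rw [thetaConst_eq, if_neg hχ, zero_mul]

/-- `Σ_{(x,y)} e(τQ(x,y)) = 1 + Σ_{(x,y)} f₀(|Q(x,y)|)`, `f₀(n) = [n ≠ 0]e(τn)`, for a positive definite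
integral form and `Im τ > 0`, with the summability of the `f₀`-series; private. [folklore] -/
private theorem tsum_cexp_eq_one_add {A B C : ℤ} (hA : 0 < A) (hdisc : B ^ 2 - 4 * A * C < 0)
    {τ : ℂ} (hτ : 0 < τ.im) :
    (Summable fun p : ℤ × ℤ =>
      (fun n : ℕ => if n = 0 then (0 : ℂ) else cexp (2 * Real.pi * I * τ * (n : ℂ)))
        (A * p.1 ^ 2 + B * p.1 * p.2 + C * p.2 ^ 2).natAbs) ∧
    (∑' p : ℤ × ℤ, cexp (2 * Real.pi * I * τ * ((A * p.1 ^ 2 + B * p.1 * p.2 + C * p.2 ^ 2 : ℤ) : ℂ))) =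
      1 + ∑' p : ℤ × ℤ,
        (fun n : ℕ => if n = 0 then (0 : ℂ) else cexp (2 * Real.pi * I * τ * (n : ℂ)))
          (A * p.1 ^ 2 + B * p.1 * p.2 + C * p.2 ^ 2).natAbs := by
  classical
  set f : ℕ → ℂ := fun n => if n = 0 then 0 else cexp (2 * Real.pi * I * τ * (n : ℂ)) with hf
  have hpos : Literature.Barriers.RiemannHypothesis.IsPosDefForm (A : ℝ) (B : ℝ) (C : ℝ) :=
    ⟨by exact_mod_cast hA, by exact_mod_cast hdisc⟩
  set g : ℤ × ℤ → ℂ := fun p => cexp (2 * Real.pi * I * τ *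
      ((A * p.1 ^ 2 + B * p.1 * p.2 + C * p.2 ^ 2 : ℤ) : ℂ)) with hg
  have hgsum : Summable g := summable_cexp_mul_bqf hA hdisc hτ
  have hfg : ∀ p : ℤ × ℤ,
      f (A * p.1 ^ 2 + B * p.1 * p.2 + C * p.2 ^ 2).natAbs = if p = 0 then 0 else g p := by
    intro p
    by_cases hp : p = 0
    · subst hp; simp [hf]
    · have hQ : 0 < Literature.Barriers.RiemannHypothesis.bqfEval (A : ℝ) (B : ℝ) (C : ℝ) p :=
        hpos.eval_pos hp
      have hQeq : Literature.Barriers.RiemannHypothesis.bqfEval (A : ℝ) (B : ℝ) (C : ℝ) p =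
          ((A * p.1 ^ 2 + B * p.1 * p.2 + C * p.2 ^ 2 : ℤ) : ℝ) := by
        unfold Literature.Barriers.RiemannHypothesis.bqfEval; push_cast; ring
      rw [hQeq] at hQ
      have hQ' : 0 < A * p.1 ^ 2 + B * p.1 * p.2 + C * p.2 ^ 2 := by exact_mod_cast hQ
      have hne : (A * p.1 ^ 2 + B * p.1 * p.2 + C * p.2 ^ 2).natAbs ≠ 0 :=
        Int.natAbs_ne_zero.mpr hQ'.ne'
      rw [if_neg hp, hf]
      simp only [hne, if_false, hg]
      congr 2
      rw [← Int.cast_natCast, Int.natAbs_of_nonneg hQ'.le]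
  have hupd : (fun p : ℤ × ℤ => if p = 0 then 0 else g p) = Function.update g 0 0 := by
    funext p; rw [Function.update_apply]
  have hsum' : Summable fun p : ℤ × ℤ => if p = 0 then 0 else g p := by
    rw [hupd]; exact hgsum.update 0 0
  refine ⟨hsum'.congr fun p => (hfg p).symm, ?_⟩
  rw [tsum_congr hfg, hgsum.tsum_eq_add_tsum_ite 0]
  have hg0 : g 0 = 1 := by simp [hg]
  rw [hg0]

/-! ### The reassembly -/

/-- **The `ω`-relation of `θ(·;ψ)` at the cusp `a/c`, modulo the phase of the binary Gauss sums**
(Conrey–Iwaniec (3.14)–(3.18) reassembled over `Cl(K)`): let `K` be imaginary quadratic with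
integral basis `(1, ω)`, `ω² = m + tω`, `d_K = t² + 4m = −q < −4`, `q` squarefree; `c ≥ 1`,
`s = (c, q)`, `𝔰 = (s, ω − k₁)` the ramified ideal over `s` (`s ∣ 2k₁ − t`, `sC₁ = k₁² − tk₁ − m`,
`gcd(s, C₁) = 1`); `ψ, g` characters of `Cl(K)` with `g² = 1`; `aā ≡ 1 (mod c)`. IF the untwisted
Gauss sums of the reduced forms satisfy `G(a,c;Q,0) = E·ν_g(𝔞_Q)` for all reduced `Q`, with
`|E| = c√s`, THEN, with `η = −i·E·ν_{ψg}(𝔰)/(c√s)` (`|η| = 1`),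
`(iy)⁻¹ θ(a/c + i/(c√r y); ψ) = η·θ(−ā r̄/c + iy/(c√r); ψg)` for all `y > 0`, i.e.
`IsOmegaRelated (c√r) η λ_ψ λ_{ψg} (thetaConst ψ) (thetaConst (ψg)) (a/c) (−ā r̄/c)` — the conclusion of
the registered stub V1 for this `c` with `ψ' = ψg`. Proof: expand over the reduced forms, transform
each binary theta series, identify each dual lattice sum with `1 + 2·`(the `ν_{ψg}`-weighted class
sum of `[𝔰𝔞_Q]⁻¹`), use `ν_ψ(𝔞_Q)⁻¹ν_g(𝔞_Q) = ν_{ψg}(𝔞_Q)⁻¹`, regroup over `Cl(K)`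
(`hasSum_sum_genusClassSum`) and compare constant terms (`thetaConst χ·(1 − ν_χ(𝔰)) = 0`).
[cite: ConreyIwaniec2002, §3 (3.14)–(3.18); Proposition 2.1 (2.35)–(2.38)] -/
theorem omegaRelated_of_gaussSum_phase (b : Basis (Fin 2) ℤ (𝓞 K)) (hb : b 0 = 1)
    {t m : ℤ} (hω : b 1 * b 1 = (m : 𝓞 K) + (t : 𝓞 K) * b 1) (hD : t ^ 2 + 4 * m < -4)
    (h2 : finrank ℚ K = 2) (hd : NumberField.discr K < -4)
    {q : ℕ} [NeZero q] (hq : Squarefree q) (hDq : t ^ 2 + 4 * m = -(q : ℤ))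
    (c : ℕ) [NeZero c] {k₁ C₁ : ℤ} (hodd : Odd ((c.gcd q : ℕ) : ℤ))
    (hk₁ : ((c.gcd q : ℕ) : ℤ) ∣ 2 * k₁ - t)
    (hC₁ : ((c.gcd q : ℕ) : ℤ) * C₁ = k₁ ^ 2 - t * k₁ - m)
    (hcop : IsCoprime ((c.gcd q : ℕ) : ℤ) C₁)
    (ψ g : ClassGroup (𝓞 K) →* ℂˣ) (hgg : g * g = 1)
    (a abar : ℤ) (hab : a * abar ≡ 1 [ZMOD c]) (E : ℂ)
    (hE : ‖E‖ = (c : ℝ) * Real.sqrt (c.gcd q : ℕ))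
    (hphase : ∀ Q ∈ reducedForms (t ^ 2 + 4 * m),
      binQuadGaussSum c ⟨Q.1, Q.2.1, Q.2.2⟩ (a : ZMod c) 0 0 =
        E * classGroupCharIdealHom g (span {(Q.1 : 𝓞 K), b 1 - (((Q.2.1 + t) / 2 : ℤ) : 𝓞 K)})) :
    ∃ η : ℂ, ‖η‖ = 1 ∧
      IsOmegaRelated ((c : ℝ) * Real.sqrt (q / c.gcd q : ℕ)) η
        (twistCount K (classGroupCharIdealHom ψ))
        (twistCount K (classGroupCharIdealHom (ψ * g)))
        (thetaConst K ψ) (thetaConst K (ψ * g))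
        ((a : ℝ) / c)
        (-((abar * ((((q / c.gcd q : ℕ) : ZMod c)⁻¹).val : ℤ) : ℤ) : ℝ) / c) := by
  classical
  have hc0 : 0 < c := Nat.pos_of_ne_zero (NeZero.ne c)
  have hq0 : 0 < q := Nat.pos_of_ne_zero (NeZero.ne q)
  have hsgcd : 0 < c.gcd q := Nat.gcd_pos_of_pos_left _ hc0
  have hs : (0 : ℤ) < ((c.gcd q : ℕ) : ℤ) := by exact_mod_cast hsgcd
  have hneg : t ^ 2 + 4 * m < 0 := by linarith
  have hrpos : 0 < (q / c.gcd q : ℕ) :=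
    Nat.div_pos (Nat.le_of_dvd hq0 (Nat.gcd_dvd_right c q)) hsgcd
  have hden : 0 < (c : ℝ) * Real.sqrt (c.gcd q : ℕ) := by
    have : 0 < Real.sqrt (c.gcd q : ℕ) := Real.sqrt_pos.mpr (by exact_mod_cast hsgcd)
    positivity
  set 𝔰 : Ideal (𝓞 K) := span {(((c.gcd q : ℕ) : ℤ) : 𝓞 K), b 1 - k₁} with h𝔰
  have h𝔰0 : 𝔰 ≠ ⊥ := fun h0 => hs.ne' (intCast_eq_zero_of_basis b hb (by
    have hmem : (((c.gcd q : ℕ) : ℤ) : 𝓞 K) ∈ 𝔰 := Ideal.subset_span (by simp)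
    rw [h0] at hmem; simpa using hmem))
  set χ : ClassGroup (𝓞 K) →* ℂˣ := ψ * g with hχ
  set P : ℂ := -I * E / ((c : ℝ) * Real.sqrt (c.gcd q : ℕ) : ℝ) with hP
  refine ⟨P * classGroupCharIdealHom χ 𝔰, ?_, ?_⟩
  · -- `|η| = 1`
    rw [norm_mul, norm_nu h𝔰0, mul_one, hP, norm_div, norm_mul, norm_neg, Complex.norm_I, one_mul,
      hE, Complex.norm_real, Real.norm_eq_abs, abs_of_pos hden, div_self hden.ne']
  intro y hy
  have hYA : 0 < 1 / ((c : ℝ) * Real.sqrt (q / c.gcd q : ℕ) * y) := by positivity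
  have hYB : 0 < y / ((c : ℝ) * Real.sqrt (q / c.gcd q : ℕ)) := by positivity
  set xB : ℝ := -((abar * ((((q / c.gcd q : ℕ) : ZMod c)⁻¹).val : ℤ) : ℤ) : ℝ) / c with hxB
  set τB : ℂ := (xB : ℂ) + (y / ((c : ℝ) * Real.sqrt (q / c.gcd q : ℕ)) : ℝ) * I with hτB
  have hτB_im : 0 < τB.im := by
    rw [hτB]; simp only [Complex.add_im, Complex.ofReal_im, Complex.mul_im, Complex.ofReal_re,
      Complex.I_im, Complex.I_re, mul_one, mul_zero, zero_add, add_zero]; exact hYB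
  set f₀ : ℕ → ℂ := fun n => if n = 0 then (0 : ℂ) else cexp (2 * Real.pi * I * τB * (n : ℂ)) with hf₀
  have hf₀0 : f₀ 0 = 0 := by simp [hf₀]
  rw [thetaValue_twistCount_eq_half_sum_binaryTheta b hb hω hD ψ ((a : ℝ) / c) hYA,
    thetaValue_twistCount_eq_half_sum_binaryTheta b hb hω hD χ xB hYB]
  set 𝔞 : ℤ × ℤ × ℤ → Ideal (𝓞 K) := fun Q =>
    span {(Q.1 : 𝓞 K), b 1 - (((Q.2.1 + t) / 2 : ℤ) : 𝓞 K)} with h𝔞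
  set S : ℤ × ℤ × ℤ → ℂ := fun Q => ∑' J : {J : Ideal (𝓞 K) // (𝔰 * 𝔞 Q * J).IsPrincipal},
    classGroupCharIdealHom χ J.1 * f₀ (absNorm J.1) with hS
  -- (1) per reduced form: `(Iy)⁻¹ Θ_Q(A) = P ν_g(𝔞_Q) (1 + 2 ν_χ(𝔰)ν_χ(𝔞_Q) S_Q)`
  have hQ : ∀ Q ∈ reducedForms (t ^ 2 + 4 * m),
      (I * y)⁻¹ * (∑' p : ℤ × ℤ, cexp (2 * Real.pi * I * ((((a : ℝ) / c : ℝ)) +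
          (1 / ((c : ℝ) * Real.sqrt (q / c.gcd q : ℕ) * y) : ℝ) * I) *
          ((Q.1 * p.1 ^ 2 + Q.2.1 * p.1 * p.2 + Q.2.2 * p.2 ^ 2 : ℤ) : ℂ))) =
        P * classGroupCharIdealHom g (𝔞 Q) *
          (1 + 2 * (classGroupCharIdealHom χ 𝔰 * classGroupCharIdealHom χ (𝔞 Q)) * S Q) := by
    intro Q hQ
    obtain ⟨hA, hC, hB, hn, hdiscQ, hprim⟩ := reducedForm_data b hb hω hneg hQ
    have hdq : Q.2.1 ^ 2 - 4 * Q.1 * Q.2.2 = -(q : ℤ) := by rw [hdiscQ, hDq]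
    have hT := binaryTheta_cusp_omega_relation Q.1 Q.2.1 Q.2.2 hA hq hdq c a abar hab hy
    have hdual := dualLatticeSum_eq_one_add_two_mul_twistedClassSum b hb hω hD h2 hd hA hC hB hn
      hprim hodd hs hk₁ hC₁ hcop hτB_im χ
    rw [hT, hdual, hphase Q hQ, hP]
    ring
  -- (2) summing over the reduced forms: the `A` side
  have hL : (I * y)⁻¹ * (1 / 2 * ∑ Q ∈ reducedForms (t ^ 2 + 4 * m),
      (classGroupCharIdealHom ψ (𝔞 Q))⁻¹ *
        ∑' p : ℤ × ℤ, cexp (2 * Real.pi * I * ((((a : ℝ) / c : ℝ)) +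
          (1 / ((c : ℝ) * Real.sqrt (q / c.gcd q : ℕ) * y) : ℝ) * I) *
          ((Q.1 * p.1 ^ 2 + Q.2.1 * p.1 * p.2 + Q.2.2 * p.2 ^ 2 : ℤ) : ℂ))) =
      P * (1 / 2 * (∑ Q ∈ reducedForms (t ^ 2 + 4 * m), (classGroupCharIdealHom χ (𝔞 Q))⁻¹) +
        classGroupCharIdealHom χ 𝔰 * ∑ Q ∈ reducedForms (t ^ 2 + 4 * m), S Q) := by
    rw [Finset.mul_sum, Finset.mul_sum]
    have step : (∑ Q ∈ reducedForms (t ^ 2 + 4 * m), (I * y)⁻¹ * (1 / 2 *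
        ((classGroupCharIdealHom ψ (𝔞 Q))⁻¹ *
          ∑' p : ℤ × ℤ, cexp (2 * Real.pi * I * ((((a : ℝ) / c : ℝ)) +
            (1 / ((c : ℝ) * Real.sqrt (q / c.gcd q : ℕ) * y) : ℝ) * I) *
            ((Q.1 * p.1 ^ 2 + Q.2.1 * p.1 * p.2 + Q.2.2 * p.2 ^ 2 : ℤ) : ℂ))))) =
        ∑ Q ∈ reducedForms (t ^ 2 + 4 * m), ((P * (1 / 2)) * (classGroupCharIdealHom χ (𝔞 Q))⁻¹ +
          (P * classGroupCharIdealHom χ 𝔰) * S Q) := by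
      have alg : ∀ Θ uψ ug T : ℂ, uψ ≠ 0 → ug * ug = 1 →
          (I * y)⁻¹ * Θ = P * ug * (1 + 2 * (classGroupCharIdealHom χ 𝔰 * (uψ * ug)) * T) →
          (I * y)⁻¹ * (1 / 2 * (uψ⁻¹ * Θ)) =
            P * (1 / 2) * (uψ * ug)⁻¹ + P * classGroupCharIdealHom χ 𝔰 * T := by
        intro Θ uψ ug T hu hg h
        rw [show (I * y)⁻¹ * (1 / 2 * (uψ⁻¹ * Θ)) = 1 / 2 * uψ⁻¹ * ((I * y)⁻¹ * Θ) by ring, h,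
          mul_inv, inv_eq_of_mul_eq_one_right hg]
        linear_combination (P * classGroupCharIdealHom χ 𝔰 * T * (ug * ug)) * inv_mul_cancel₀ hu +
          (P * classGroupCharIdealHom χ 𝔰 * T) * hg
      refine Finset.sum_congr rfl fun Q hQ' => ?_
      have h𝔞0 : 𝔞 Q ≠ ⊥ :=
        nonZeroDivisors.ne_zero (formIdeal_mem_nonZeroDivisors b hb hneg ⟨Q, hQ'⟩)
      have hνψ : classGroupCharIdealHom ψ (𝔞 Q) ≠ 0 := by
        rw [← norm_pos_iff, norm_nu h𝔞0]; exact one_pos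
      have hχeq : classGroupCharIdealHom χ (𝔞 Q) =
          classGroupCharIdealHom ψ (𝔞 Q) * classGroupCharIdealHom g (𝔞 Q) := by rw [hχ, nu_mul]
      have h := hQ Q hQ'
      rw [hχeq] at h ⊢
      exact alg _ _ _ _ hνψ (nu_sq_eq_one hgg h𝔞0) h
    rw [step, Finset.sum_add_distrib, ← Finset.mul_sum, ← Finset.mul_sum]
    ring
  -- (3) the `B` side: `θ_B = thetaConst χ + Σ_Q S_Q`
  have hTQ : ∀ Q ∈ reducedForms (t ^ 2 + 4 * m),
      (Summable fun p : ℤ × ℤ => f₀ (Q.1 * p.1 ^ 2 + Q.2.1 * p.1 * p.2 + Q.2.2 * p.2 ^ 2).natAbs) ∧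
      (∑' p : ℤ × ℤ, cexp (2 * Real.pi * I * τB *
          ((Q.1 * p.1 ^ 2 + Q.2.1 * p.1 * p.2 + Q.2.2 * p.2 ^ 2 : ℤ) : ℂ))) =
        1 + ∑' p : ℤ × ℤ, f₀ (Q.1 * p.1 ^ 2 + Q.2.1 * p.1 * p.2 + Q.2.2 * p.2 ^ 2).natAbs := by
    intro Q hQ'
    obtain ⟨hA, -, -, -, hdiscQ, -⟩ := reducedForm_data b hb hω hneg hQ'
    exact tsum_cexp_eq_one_add hA (by rw [hdiscQ]; exact hneg) hτB_im
  have hν0 : classGroupCharIdealHom χ (⊥ : Ideal (𝓞 K)) * f₀ (absNorm (⊥ : Ideal (𝓞 K))) = 0 := by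
    rw [classGroupCharIdealHom_bot, zero_mul]
  have hG2 := hasSum_classGroupCharIdealHom_mul_weight b hb hω hD χ hf₀0 fun Q hQ' => (hTQ Q hQ').1
  have hW : (∑ Q ∈ reducedForms (t ^ 2 + 4 * m), S Q) =
      1 / 2 * ∑ Q ∈ reducedForms (t ^ 2 + 4 * m), (classGroupCharIdealHom χ (𝔞 Q))⁻¹ *
        ∑' p : ℤ × ℤ, f₀ (Q.1 * p.1 ^ 2 + Q.2.1 * p.1 * p.2 + Q.2.2 * p.2 ^ 2).natAbs :=
    (hasSum_sum_genusClassSum b hb hω hneg h𝔰0 hν0 hG2.summable).unique hG2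
  have hconst : 1 / 2 * (∑ Q ∈ reducedForms (t ^ 2 + 4 * m), (classGroupCharIdealHom χ (𝔞 Q))⁻¹) =
      thetaConst K χ := by
    rw [sum_reducedForms_inv_classGroupCharIdealHom b hb hω hneg χ, thetaConst]
  have hR : (1 / 2 * ∑ Q ∈ reducedForms (t ^ 2 + 4 * m),
      (classGroupCharIdealHom χ (𝔞 Q))⁻¹ *
        ∑' p : ℤ × ℤ, cexp (2 * Real.pi * I * ((xB : ℂ) +
          (y / ((c : ℝ) * Real.sqrt (q / c.gcd q : ℕ)) : ℝ) * I) *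
          ((Q.1 * p.1 ^ 2 + Q.2.1 * p.1 * p.2 + Q.2.2 * p.2 ^ 2 : ℤ) : ℂ))) =
      thetaConst K χ + ∑ Q ∈ reducedForms (t ^ 2 + 4 * m), S Q := by
    rw [hW, ← hconst, Finset.mul_sum, Finset.mul_sum, Finset.mul_sum, ← Finset.sum_add_distrib]
    refine Finset.sum_congr rfl fun Q hQ' => ?_
    rw [show ((xB : ℂ) + (y / ((c : ℝ) * Real.sqrt (q / c.gcd q : ℕ)) : ℝ) * I) = τB from rfl,
      (hTQ Q hQ').2]
    ring
  -- (4) assemble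
  rw [hL, hR, hconst]
  linear_combination P * thetaConst_mul_one_sub_nu χ h𝔰0

end ConreyIwaniec2002

end Literature.NumberTheory.LFunctions
end
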